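import Summits.QuantumFields.YangMills.Theorems.SwapVirialDeficitNearFlatTubeFloor
import Summits.QuantumFields.YangMills.Theorems.SwapVirialDeficitNearFlatHubComm
import HarnessLib

/-!
# THE PRODUCT FLOOR AT THE CROSSING Σ (leader side): (distance to stratum A)² × (distance to stratum B)² ≤ 18·(relations)², for EVERY configuration
# (free-hands support of ⟨stmt-QuantumFields-24197⟩ `SwapVirialDeficit.SwapGluedStiffness`; LEAD g99 memo8 §3 (Σ2) «Łojasiewicz with the product exponent near
# Σ = A ∩ B̄» — the leader-side half, hypothesis-free; input of the END-CORE weight bound `stub_core_end` of skeleton ➎)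

Letters (✓`…NearFlatTubeFloor`): unit hub `c` (`δ = re c`), unit `C₀` (`t₀ = ‖im C₀‖`, `g = ⟪im c, im C₀⟫`), slaved `C₁ = c̄C₀cZ` (`Z` unit), unit `C₂` (`t₂ = ‖im C₂‖`).
TRANSVERSE WEIGHT `T := t₀²‖im c‖² − g²` (`= t₀²·Q`, the squared transverse part of `C₀`'s axis relative to the hub: VANISHES EXACTLY ON STRATUM A near the end);
B-WEIGHT `16(t₀²δ² + g²) + 4t₂²` (hub-polar², axial², `C₂`-centrality: VANISHES EXACTLY ON STRATUM B, given `Z = 1`).  Then, with NO hypothesis beyond unit norms: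
* ★★★ `sigma_product_floor`:  `T · (16(t₀²δ² + g²) + 4t₂²) ≤ (‖[C₀,C₁]‖ + 2‖cC₁ − C₀c‖)² + (t₀·‖cC₂ − C₂c‖ + 2‖[C₀,C₂]‖)²`
  (✓`sq_norm_comm_conj` for the first bracket — `16·(t₀²P)·(t₀²Q)` IS the conjugate commutator — and the coaxialization of `C₂` at `C₀` for the second; at `t₀ = 0` both
  sides' left factor vanish).  With ✓`relations_le_of_chartDeficit` (every relation `≤ 60L³√F̂/√2`) the right side is `≤ 18·(60L³)²·F̂/2·(…)`, i.e. the product floor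
  `F̂ ≳ dist(·,A)²·dist(·,B)²/L⁶` of memo8 in quaternion letters; the slaving letter and the followers are separately `≤ relations` (✓`norm_sigmaWord_slaved`,
  ✓`relations_le_of_chartDeficit`).  The transfer to the gnomonic end-core letters `(u; δ, x₀, y₀)` — `T ≍ |u|²/(1+|x|²)`, bracket `≍ δ² + x₀²/(1+|x|²) + |y|²/(1+|y|²)` —
  is the consumer's (stub_core_end owner).
* `sigma_product_floor_of_le` — the same with all four relations `≤ m`: `T·(16(t₀²δ² + g²) + 4t₂²) ≤ 18m²`.
* §2 (appended) ★★ `hubPolar_product_floor` — the SECOND σ-word sees the hub-polar letter WITHOUT the factor `t₀²` (which degenerates at Σ where `C₀ → ±1`):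
  `16(re c)²·T ≤ (‖cC₁ − C₀c‖ + ‖cC₀ − C₁c‖)²` (w3's ✓`norm_comm_hub_le` + Lagrange ✓`norm_comm_sq_lagrange`), and ★★★ `sigma_product_floor_full_of_le` (all FIVE
  relations `≤ m`): `T·(16(re c)² + 16(t₀²(re c)² + g²) + 4t₂²) ≤ 22m²` — the bracket is now `≍ δ² + g² + t₂²` with NON-degenerate coefficients at Σ, exactly the
  normal form `|u|²·(k₁δ² + k₂x₀² + k₃y₀²)` of memo8 §1 (k₁ from the σ-word, k₂, k₃ from the commutators).

HONEST LABEL: elementary quaternion algebra; stubs B ∕ core-tip ∕ core-end ∕ 001-good of skeleton ➎, ⟨24197⟩ ∕ ⟨24194⟩ ∕ ⟨24497⟩ OPEN; own crux ⟨22884⟩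
`LargeFieldMassRefinementTail` OPEN (blocked-on ⟨19935⟩); the Yang–Mills mass gap is NOT proved; no summit is proved by a line.  THEOREMS ONLY (0 `def`, 0 `sorry`),
standard axioms.  LEAD seat ym-line-sfw-p2 g99 (cell ym-idea-1, free hands), `--supports stmt-QuantumFields-24197`.  References: [folklore].
-/

set_option autoImplicit false

noncomputable section

open Quaternion
open scoped Quaternion RealInnerProductSpace
open Literature.MathematicalPhysics.QuantumLattice (sq_norm_eq_sum_sq)

namespace Summit.QuantumFields.YangMills.Theorems.SwapVirialDeficit.NearFlat

/-- The `C₂`-part of the product floor: `4t₂²·(t₀²‖im c‖² − ⟪im c, im C₀⟫²) ≤ (t₀‖cC₂ − C₂c‖ + 2‖[C₀,C₂]‖)²` for unit `c, C₂` and any `C₀`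
(coaxialize `C₂` at `C₀`, then ✓`sq_norm_comm_coax_unit`). [folklore] -/
theorem c2_product_floor {c C₀ C₂ : ℍ} (hc : ‖c‖ = 1) (hC₂ : ‖C₂‖ = 1) :
    4 * ‖C₂.im‖ ^ 2 * (‖C₀.im‖ ^ 2 * ‖c.im‖ ^ 2 - ⟪c.im, C₀.im⟫ ^ 2) ≤
      (‖C₀.im‖ * ‖c * C₂ - C₂ * c‖ + 2 * ‖C₀ * C₂ - C₂ * C₀‖) ^ 2 := by
  by_cases h0 : C₀.im = 0
  · rw [h0]; simp
  have ht₀0 : 0 < ‖C₀.im‖ := norm_pos_iff.2 h0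
  obtain ⟨C₂', hre, ⟨t, ht⟩, hnorm, -, hdist⟩ := exists_coaxial_near h0 C₂
  have hC₂'1 : ‖C₂'‖ = 1 := norm_eq_one_of_sq (by rw [hnorm, hC₂, one_pow])
  -- the transferred commutator word, multiplied through by `t₀`
  have hw : ‖c * C₂' - C₂' * c‖ ≤ ‖c * C₂ - C₂ * c‖ + 2 * ‖C₂ - C₂'‖ := by
    have h := comm_lipschitz (A := c) (B := C₂) (A' := c) (B' := C₂') (by rw [hc]) (by rw [hC₂])
    rw [sub_self, norm_zero, mul_zero, add_zero] at h
    exact h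
  have hwt : ‖C₀.im‖ * ‖c * C₂' - C₂' * c‖ ≤ ‖C₀.im‖ * ‖c * C₂ - C₂ * c‖ + 2 * ‖C₀ * C₂ - C₂ * C₀‖ := by
    have h1 : ‖C₀.im‖ * ‖C₂ - C₂'‖ ≤ ‖C₀ * C₂ - C₂ * C₀‖ := by
      have := hdist; rw [le_div_iff₀ ht₀0] at this; linarith
    nlinarith [mul_le_mul_of_nonneg_left hw ht₀0.le]
  -- the coax letters and the word identity
  obtain ⟨e, -⟩ := coax_letters_of_im_eq_smul (Quaternion.re_im C₀) h0 hC₂'1 ht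
  have hv : (‖C₀.im‖⁻¹ • C₀.im).re = 0 := by rw [Quaternion.re_smul, Quaternion.re_im, smul_zero]
  have hv1 : ‖(‖C₀.im‖⁻¹ • C₀.im)‖ = 1 := by rw [norm_smul, norm_inv, norm_norm, inv_mul_cancel₀ ht₀0.ne']
  have hword := sq_norm_comm_coax_unit hv hv1 c C₂'.re (t * ‖C₀.im‖)
  rw [← e, inner_smul_right] at hword
  have him : ‖C₂.im‖ ^ 2 = (t * ‖C₀.im‖) ^ 2 := by
    have h1 : ‖C₂'.im‖ ^ 2 = (t * ‖C₀.im‖) ^ 2 := by rw [ht, norm_smul, Real.norm_eq_abs, mul_pow, sq_abs, mul_pow]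
    have e1 : ‖C₂‖ ^ 2 = C₂.re ^ 2 + ‖C₂.im‖ ^ 2 := by
      rw [sq_norm_eq_sum_sq C₂, sq_norm_eq_sum_sq C₂.im, Quaternion.re_im, Quaternion.imI_im, Quaternion.imJ_im, Quaternion.imK_im]; ring
    have e2 : ‖C₂'‖ ^ 2 = C₂'.re ^ 2 + ‖C₂'.im‖ ^ 2 := by
      rw [sq_norm_eq_sum_sq C₂', sq_norm_eq_sum_sq C₂'.im, Quaternion.re_im, Quaternion.imI_im, Quaternion.imJ_im, Quaternion.imK_im]; ring
    rw [hre] at e2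
    rw [← h1]; linarith [hnorm]
  -- `t₀²·‖cC₂' − C₂'c‖² = 4 t₂² (t₀²‖im c‖² − g²)`
  have key : (‖C₀.im‖ * ‖c * C₂' - C₂' * c‖) ^ 2 = 4 * ‖C₂.im‖ ^ 2 * (‖C₀.im‖ ^ 2 * ‖c.im‖ ^ 2 - ⟪c.im, C₀.im⟫ ^ 2) := by
    rw [mul_pow, hword, him]
    field_simp
  rw [← key]
  exact pow_le_pow_left₀ (by positivity) hwt 2

/-- ★★★ **THE PRODUCT FLOOR AT Σ** (hypothesis-free beyond unit norms): with `T = t₀²‖im c‖² − ⟪im c, im C₀⟫²` (transverse weight: stratum A is `T = 0`) and the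
B-bracket `16(t₀²(re c)² + ⟪im c, im C₀⟫²) + 4‖im C₂‖²` (stratum B is bracket `= 0`),
`T · bracket ≤ (‖[C₀,C₁]‖ + 2‖cC₁ − C₀c‖)² + (t₀‖cC₂ − C₂c‖ + 2‖[C₀,C₂]‖)²`, `C₁ = c̄C₀cZ`. [folklore] -/
theorem sigma_product_floor {c C₀ C₂ Z : ℍ} (hc : ‖c‖ = 1) (hC₀ : ‖C₀‖ = 1) (hC₂ : ‖C₂‖ = 1) (hZ : ‖Z‖ = 1) :
    (‖C₀.im‖ ^ 2 * ‖c.im‖ ^ 2 - ⟪c.im, C₀.im⟫ ^ 2) * (16 * (‖C₀.im‖ ^ 2 * c.re ^ 2 + ⟪c.im, C₀.im⟫ ^ 2) + 4 * ‖C₂.im‖ ^ 2) ≤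
      (‖C₀ * (star c * C₀ * c * Z) - (star c * C₀ * c * Z) * C₀‖ + 2 * ‖c * (star c * C₀ * c * Z) - C₀ * c‖) ^ 2 +
        (‖C₀.im‖ * ‖c * C₂ - C₂ * c‖ + 2 * ‖C₀ * C₂ - C₂ * C₀‖) ^ 2 := by
  -- first bracket: the conjugate commutator
  have hconj : ‖C₀ * (star c * C₀ * c) - (star c * C₀ * c) * C₀‖ ≤
      ‖C₀ * (star c * C₀ * c * Z) - (star c * C₀ * c * Z) * C₀‖ + 2 * ‖c * (star c * C₀ * c * Z) - C₀ * c‖ := by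
    have hB : ‖star c * C₀ * c * Z‖ ≤ 1 := by
      rw [norm_mul, norm_mul, norm_mul, Quaternion.norm_star, hc, hC₀, hZ]; norm_num
    have h := comm_lipschitz (A := C₀) (B := star c * C₀ * c * Z) (A' := C₀) (B' := star c * C₀ * c) (by rw [hC₀]) hB
    rw [sub_self, norm_zero, mul_zero, add_zero, norm_slaved_sub_conj hc hC₀ Z, ← norm_sigmaWord_slaved hc hC₀ Z] at h
    exact h
  have h1 : 16 * (‖C₀.im‖ ^ 2 * c.re ^ 2 + ⟪c.im, C₀.im⟫ ^ 2) * (‖C₀.im‖ ^ 2 * ‖c.im‖ ^ 2 - ⟪c.im, C₀.im⟫ ^ 2) ≤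
      (‖C₀ * (star c * C₀ * c * Z) - (star c * C₀ * c * Z) * C₀‖ + 2 * ‖c * (star c * C₀ * c * Z) - C₀ * c‖) ^ 2 := by
    rw [← sq_norm_comm_conj]
    exact pow_le_pow_left₀ (norm_nonneg _) hconj 2
  have h2 := c2_product_floor (C₀ := C₀) hc hC₂
  nlinarith [h1, h2]

/-- ★ **The product floor with all four relations `≤ m`**: `T·(16(t₀²δ² + g²) + 4t₂²) ≤ 18m²`. [folklore] -/
theorem sigma_product_floor_of_le {c C₀ C₂ Z : ℍ} (hc : ‖c‖ = 1) (hC₀ : ‖C₀‖ = 1) (hC₂ : ‖C₂‖ = 1) (hZ : ‖Z‖ = 1) {m : ℝ}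
    (h01 : ‖C₀ * (star c * C₀ * c * Z) - (star c * C₀ * c * Z) * C₀‖ ≤ m) (h02 : ‖C₀ * C₂ - C₂ * C₀‖ ≤ m)
    (hs0 : ‖c * (star c * C₀ * c * Z) - C₀ * c‖ ≤ m) (hs2 : ‖c * C₂ - C₂ * c‖ ≤ m) :
    (‖C₀.im‖ ^ 2 * ‖c.im‖ ^ 2 - ⟪c.im, C₀.im⟫ ^ 2) * (16 * (‖C₀.im‖ ^ 2 * c.re ^ 2 + ⟪c.im, C₀.im⟫ ^ 2) + 4 * ‖C₂.im‖ ^ 2) ≤ 18 * m ^ 2 := by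
  have h := sigma_product_floor hc hC₀ hC₂ hZ
  have hm0 : 0 ≤ m := le_trans (norm_nonneg _) hs2
  have ht₀1 : ‖C₀.im‖ ≤ 1 := by
    have e1 : ‖C₀‖ ^ 2 = C₀.re ^ 2 + ‖C₀.im‖ ^ 2 := by
      rw [sq_norm_eq_sum_sq C₀, sq_norm_eq_sum_sq C₀.im, Quaternion.re_im, Quaternion.imI_im, Quaternion.imJ_im, Quaternion.imK_im]; ring
    rw [hC₀, one_pow] at e1
    nlinarith [sq_nonneg C₀.re, norm_nonneg C₀.im]
  have ha : ‖C₀ * (star c * C₀ * c * Z) - (star c * C₀ * c * Z) * C₀‖ + 2 * ‖c * (star c * C₀ * c * Z) - C₀ * c‖ ≤ 3 * m := by linarith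
  have hb : ‖C₀.im‖ * ‖c * C₂ - C₂ * c‖ + 2 * ‖C₀ * C₂ - C₂ * C₀‖ ≤ 3 * m := by
    nlinarith [mul_le_mul ht₀1 hs2 (norm_nonneg _) zero_le_one, norm_nonneg (c * C₂ - C₂ * c)]
  have ha0 : 0 ≤ ‖C₀ * (star c * C₀ * c * Z) - (star c * C₀ * c * Z) * C₀‖ + 2 * ‖c * (star c * C₀ * c * Z) - C₀ * c‖ := by positivity
  have hb0 : 0 ≤ ‖C₀.im‖ * ‖c * C₂ - C₂ * c‖ + 2 * ‖C₀ * C₂ - C₂ * C₀‖ := by positivity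
  nlinarith [pow_le_pow_left₀ ha0 ha 2, pow_le_pow_left₀ hb0 hb 2]


/-! ## §2 (appended, LEAD g99) The hub-polar letter through the second σ-word — non-degenerate at Σ -/

/-- ★★ **THE HUB-POLAR PRODUCT FLOOR**: `16(re c)²·(t₀²‖im c‖² − ⟪im c, im C₀⟫²) ≤ (‖cC₁ − C₀c‖ + ‖cC₀ − C₁c‖)²` for a unit hub `c` and ANY `C₀, C₁`
(`[c², C₀] = 2 re(c)·[c, C₀]` is a combination of the two σ-words, and `‖[c, C₀]‖² = 4T` by Lagrange). [folklore] -/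
theorem hubPolar_product_floor {c : ℍ} (hc : ‖c‖ = 1) (C₀ C₁ : ℍ) :
    16 * c.re ^ 2 * (‖C₀.im‖ ^ 2 * ‖c.im‖ ^ 2 - ⟪c.im, C₀.im⟫ ^ 2) ≤ (‖c * C₁ - C₀ * c‖ + ‖c * C₀ - C₁ * c‖) ^ 2 := by
  have h := norm_comm_hub_le hc C₀ C₁
  have h0 : 0 ≤ 2 * |c.re| * ‖c * C₀ - C₀ * c‖ := by positivity
  have hsq := pow_le_pow_left₀ h0 h 2
  have hlag : ‖c * C₀ - C₀ * c‖ ^ 2 = 4 * (‖c.im‖ ^ 2 * ‖C₀.im‖ ^ 2 - ⟪c.im, C₀.im⟫ ^ 2) := norm_comm_sq_lagrange c C₀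
  have e : (2 * |c.re| * ‖c * C₀ - C₀ * c‖) ^ 2 = 16 * c.re ^ 2 * (‖C₀.im‖ ^ 2 * ‖c.im‖ ^ 2 - ⟪c.im, C₀.im⟫ ^ 2) := by
    rw [mul_pow, mul_pow, sq_abs, hlag]; ring
  rw [← e]; exact hsq

/-- ★★★ **THE FULL PRODUCT FLOOR AT Σ** (all five relations `≤ m`): `T·(16(re c)² + 16(t₀²(re c)² + ⟪im c, im C₀⟫²) + 4‖im C₂‖²) ≤ 22m²` — the bracket has
NON-degenerate coefficients in the hub-polar, axial and `C₂` letters as the configuration approaches Σ (`im C₀ → 0`). [folklore] -/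
theorem sigma_product_floor_full_of_le {c C₀ C₂ Z : ℍ} (hc : ‖c‖ = 1) (hC₀ : ‖C₀‖ = 1) (hC₂ : ‖C₂‖ = 1) (hZ : ‖Z‖ = 1) {m : ℝ}
    (h01 : ‖C₀ * (star c * C₀ * c * Z) - (star c * C₀ * c * Z) * C₀‖ ≤ m) (h02 : ‖C₀ * C₂ - C₂ * C₀‖ ≤ m)
    (hs0 : ‖c * (star c * C₀ * c * Z) - C₀ * c‖ ≤ m) (hs1 : ‖c * C₀ - (star c * C₀ * c * Z) * c‖ ≤ m) (hs2 : ‖c * C₂ - C₂ * c‖ ≤ m) :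
    (‖C₀.im‖ ^ 2 * ‖c.im‖ ^ 2 - ⟪c.im, C₀.im⟫ ^ 2) *
        (16 * c.re ^ 2 + 16 * (‖C₀.im‖ ^ 2 * c.re ^ 2 + ⟪c.im, C₀.im⟫ ^ 2) + 4 * ‖C₂.im‖ ^ 2) ≤ 22 * m ^ 2 := by
  have h1 := sigma_product_floor_of_le hc hC₀ hC₂ hZ h01 h02 hs0 hs2
  have h2 := hubPolar_product_floor hc C₀ (star c * C₀ * c * Z)
  have h3 : (‖c * (star c * C₀ * c * Z) - C₀ * c‖ + ‖c * C₀ - (star c * C₀ * c * Z) * c‖) ^ 2 ≤ (2 * m) ^ 2 :=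
    pow_le_pow_left₀ (by positivity) (by linarith) 2
  nlinarith [h1, h2, h3]

end Summit.QuantumFields.YangMills.Theorems.SwapVirialDeficit.NearFlat

end
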